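import Summits.CriticalPhenomena.PercolationContinuityZ3.Theorems.PercFiniteBoxLRORenormaliseFromLinearLROStubDenseMarkovPointwise
import Summits.CriticalPhenomena.PercolationContinuityZ3.Theorems.PercFiniteBoxLRORenormaliseFromLinearLROStubLargeCountMoments

/-!
# `stub_denseMarkov` of line `registered` (crux `PercFiniteBoxLRO.RenormaliseFromLinearLRO`,
# stmt-CriticalPhenomena-0857, reshape 2): the second-moment boost

With `G = coreGrid s m` (`g = (2m+1)³`), `θ_s = P_p(0 ↔ ∂Λ(s))`, `X = largeCount s G`,
`Y = Σ_{y,y' ∈ G} 1[y ↔ y' inside Λ(Kn)]`: if `E[Y] ≥ (1 − η) θ_s² g²` then `P_p(not dense) ≤ 48η + 200/(θ_s² m³)`.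
Proof: expectations of the pointwise inequalities of `…StubDenseMarkovPointwise.lean` (p159526) —
`12 E[Y] ≤ 12 g + 12 E[X²] − E[1_F X²]` a.s., `E[X²] ≤ gθ_s + g²θ_s²` (`…StubLargeCountMoments.lean`, p158461) ⇒
`E[1_F X²] ≤ 24 g + 12ηθ_s²g²`; Markov on `F ∩ {X > θ_s g/2}` (`≤ 96/(θ_s²g) + 48η`); Chebyshev from two moments
for the core grid and the four half-grids (`≤ 4/(θ_s g_j)` each); off these events a non-dense `ω` is impossible
(pointwise (E)); `g ≥ g_j ≥ g/2 ≥ m³`, `θ_s ≤ 1`.  Pure theorem file; lands `--supports stmt-CriticalPhenomena-0857`.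
-/

noncomputable section

namespace Summit.CriticalPhenomena.PercolationContinuityZ3.Theorems.RenormaliseFromLinearLRO

open Literature.Probability.Percolation Literature.Probability.LatticeModels
open MeasureTheory

/-! ## Bounded random variables on the percolation space; cardinalities of the grids -/

/-- A measurable real function bounded by a constant is integrable under `P_p`. -/
theorem markov_integrable_of_bound (p : unitInterval) {f : BondConfig (Site 3) → ℝ} (hf : Measurable f)
    {C : ℝ} (hb : ∀ ω, |f ω| ≤ C) : Integrable f (bondPercolation (zdGraph 3) p) :=
  (integrable_const C).mono' hf.aestronglyMeasurable (ae_of_all _ fun ω => by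
    rw [Real.norm_eq_abs]; exact hb ω)

/-- **Chebyshev from two moments.**  If `E[f] = a` and `E[f²] ≤ a + a²` for a bounded measurable `f`, then
`P(|f − a| ≥ t) ≤ a / t²` (`E[(f − a)²] = E[f²] − a² ≤ a`, then Markov). -/
theorem markov_chebyshev (p : unitInterval) {f : BondConfig (Site 3) → ℝ} (hf : Measurable f) {C : ℝ}
    (hb : ∀ ω, |f ω| ≤ C) {a t : ℝ} (h1 : ∫ ω, f ω ∂(bondPercolation (zdGraph 3) p) = a)
    (h2 : ∫ ω, f ω ^ 2 ∂(bondPercolation (zdGraph 3) p) ≤ a + a ^ 2) (ht : 0 < t) :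
    (bondPercolation (zdGraph 3) p).real {ω | t ≤ |f ω - a|} ≤ a / t ^ 2 := by
  set P := bondPercolation (zdGraph 3) p with hP
  have hfi : Integrable f P := markov_integrable_of_bound p hf hb
  have hf2i : Integrable (fun ω => f ω ^ 2) P := by
    refine markov_integrable_of_bound p (hf.pow_const 2) (C := C ^ 2) fun ω => ?_
    rw [abs_pow]
    exact pow_le_pow_left₀ (abs_nonneg _) (hb ω) 2
  have hdev : Integrable (fun ω => (f ω - a) ^ 2) P := by
    refine markov_integrable_of_bound p ((hf.sub_const a).pow_const 2) (C := (C + |a|) ^ 2) fun ω => ?_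
    rw [abs_pow]
    refine pow_le_pow_left₀ (abs_nonneg _) ?_ 2
    calc |f ω - a| ≤ |f ω| + |a| := abs_sub _ _
      _ ≤ C + |a| := by linarith [hb ω]
  -- E[(f - a)²] ≤ a
  have hE : ∫ ω, (f ω - a) ^ 2 ∂P ≤ a := by
    have hexp : (fun ω => (f ω - a) ^ 2) = fun ω => f ω ^ 2 - 2 * a * f ω + a ^ 2 := by
      funext ω; ring
    have i2 : Integrable (fun ω => 2 * a * f ω) P := hfi.const_mul (2 * a)
    have i3 : Integrable (fun ω => f ω ^ 2 - 2 * a * f ω) P := hf2i.sub i2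
    have e1 : ∫ ω, (f ω ^ 2 - 2 * a * f ω + a ^ 2) ∂P = (∫ ω, f ω ^ 2 ∂P) - 2 * a * (∫ ω, f ω ∂P) + a ^ 2 := by
      rw [integral_add i3 (integrable_const _), integral_sub hf2i i2, integral_const_mul, integral_const,
        probReal_univ, one_smul]
    rw [hexp, e1, h1]
    nlinarith [h2]
  -- Markov
  have hmeas : MeasurableSet {ω | t ≤ |f ω - a|} :=
    measurableSet_le measurable_const (continuous_abs.measurable.comp (hf.sub_const a))
  have hptw : ∀ ω, ({ω | t ≤ |f ω - a|} : Set (BondConfig (Site 3))).indicator (fun _ => t ^ 2) ω ≤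
      (f ω - a) ^ 2 := by
    intro ω
    by_cases hω : ω ∈ {ω | t ≤ |f ω - a|}
    · rw [Set.indicator_of_mem hω]
      have h : t ≤ |f ω - a| := hω
      calc t ^ 2 ≤ |f ω - a| ^ 2 := pow_le_pow_left₀ ht.le h 2
        _ = (f ω - a) ^ 2 := sq_abs _
    · rw [Set.indicator_of_notMem hω]
      positivity
  have hint : P.real {ω | t ≤ |f ω - a|} * t ^ 2 ≤ a := by
    have h := integral_mono ((integrable_const (t ^ 2)).indicator hmeas) hdev hptw
    rw [integral_indicator_const _ hmeas, smul_eq_mul] at h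
    exact h.trans hE
  rw [le_div_iff₀ (pow_pos ht 2)]
  exact hint

/-! ## Cardinalities of the grids -/

/-- The core grid is symmetric under `x ↦ -x`. -/
theorem markov_neg_mem_coreGrid {s m : ℕ} {x : Site 3} (hx : x ∈ coreGrid s m) : -x ∈ coreGrid s m := by
  obtain ⟨z, hz, rfl⟩ := mem_coreGrid.1 hx
  refine mem_coreGrid.2 ⟨-z, ?_, ?_⟩
  · rw [mem_box] at hz ⊢
    intro i
    have := hz i
    simp only [Pi.neg_apply]
    omega
  · funext i
    simp [gridPt_apply]

/-- Each half-grid holds at least half of the core grid: `|G| ≤ 2 |G_{i,b}|` (the two halves of direction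
`i` cover the core grid and are exchanged by `x ↦ -x`). -/
theorem markov_card_coreGrid_le_two_mul (s m : ℕ) (i : Fin 2) (b : Bool) :
    (coreGrid s m).card ≤ 2 * (halfGrid s m i b).card := by
  classical
  -- the two halves cover
  have hcover : coreGrid s m ⊆ halfGrid s m i true ∪ halfGrid s m i false := by
    intro x hx
    rw [Finset.mem_union]
    by_cases h : 0 ≤ x (Fin.castSucc i)
    · exact Or.inl (Finset.mem_filter.2 ⟨hx, by simp [h]⟩)
    · exact Or.inr (Finset.mem_filter.2 ⟨hx, by simp; omega⟩)
  -- the two halves have the same cardinality (negation)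
  have hneg : ∀ b' : Bool, (halfGrid s m i b').card ≤ (halfGrid s m i (!b')).card := by
    intro b'
    have himage : (halfGrid s m i b').image (fun x : Site 3 => -x) ⊆ halfGrid s m i (!b') := by
      intro y hy
      obtain ⟨x, hx, rfl⟩ := Finset.mem_image.1 hy
      obtain ⟨hxG, hxs⟩ := Finset.mem_filter.1 hx
      refine Finset.mem_filter.2 ⟨markov_neg_mem_coreGrid hxG, ?_⟩
      cases b' <;> simp at hxs ⊢ <;> omega
    calc (halfGrid s m i b').card = ((halfGrid s m i b').image (fun x : Site 3 => -x)).card :=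
          (Finset.card_image_of_injective _ neg_injective).symm
      _ ≤ (halfGrid s m i (!b')).card := Finset.card_le_card himage
  have h1 := Finset.card_le_card hcover
  have h2 := Finset.card_union_le (halfGrid s m i true) (halfGrid s m i false)
  have h3 := hneg true
  have h4 := hneg false
  simp only [Bool.not_true, Bool.not_false] at h3 h4
  cases b <;> omega

/-- The event "no base point is joined to `11/12` of the locally-large points of `G`" is measurable
(a countable intersection of comparisons of measurable counts). -/
theorem markov_measurableSet_noCapture (s : ℕ) (Sf G : Finset (Site 3)) :
    MeasurableSet {ω' : BondConfig (Site 3) | ∀ x : Site 3,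
      12 * joinedCount s ↑Sf G x ω' < 11 * largeCount s G ω'} := by
  have hrepr : {ω' : BondConfig (Site 3) | ∀ x : Site 3, 12 * joinedCount s ↑Sf G x ω' < 11 * largeCount s G ω'}
      = ⋂ x : Site 3, {ω' | (12 : ℝ) * (joinedCount s ↑Sf G x ω' : ℝ) < 11 * (largeCount s G ω' : ℝ)} := by
    ext ω'
    simp only [Set.mem_setOf_eq, Set.mem_iInter]
    refine forall_congr' fun x => ⟨fun h => by exact_mod_cast h, fun h => by exact_mod_cast h⟩
  rw [hrepr]
  exact MeasurableSet.iInter fun x =>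
    measurableSet_lt ((measurable_joinedCount s Sf G x).const_mul _) ((measurable_largeCount s G).const_mul _)

/-- `|X²| ≤ |G|²` for `X = largeCount s G`. -/
theorem markov_abs_largeCount_sq_le (s : ℕ) (G : Finset (Site 3)) (ω : BondConfig (Site 3)) :
    |(largeCount s G ω : ℝ) ^ 2| ≤ (G.card : ℝ) ^ 2 := by
  rw [abs_pow, abs_of_nonneg (by positivity)]
  exact pow_le_pow_left₀ (by positivity) (by exact_mod_cast largeCount_le_card s G ω) 2

/-! ## The expectation step -/

/-- **`E[1_F X²] ≤ 24 g + 12 η θ_s² g²`** from the pair-sum hypothesis, pointwise (A) almost surely, and the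
second moment of `X`. -/
theorem markov_integral_indicator_sq_le (p : unitInterval) (K s m : ℕ) (η : ℝ)
    (hpairs : (1 - η) * (bondPercolation (zdGraph 3) p).real (siteToBoundary 3 s) ^ 2 *
        ((coreGrid s m).card : ℝ) ^ 2 ≤
      ∑ y ∈ coreGrid s m, ∑ y' ∈ coreGrid s m,
        (bondPercolation (zdGraph 3) p).real (openConnIn ↑(box 3 (K * ((2 * s + 1) * m))) y y')) :
    ∫ ω, {ω' : BondConfig (Site 3) | ∀ x : Site 3,
        12 * joinedCount s ↑(box 3 (K * ((2 * s + 1) * m))) (coreGrid s m) x ω' <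
          11 * largeCount s (coreGrid s m) ω'}.indicator
        (fun ω' => (largeCount s (coreGrid s m) ω' : ℝ) ^ 2) ω ∂(bondPercolation (zdGraph 3) p) ≤
      24 * ((coreGrid s m).card : ℝ) +
        12 * η * (bondPercolation (zdGraph 3) p).real (siteToBoundary 3 s) ^ 2 * ((coreGrid s m).card : ℝ) ^ 2 := by
  set P := bondPercolation (zdGraph 3) p with hP
  set G := coreGrid s m with hG
  set g : ℝ := (G.card : ℝ) with hg
  set θs : ℝ := P.real (siteToBoundary 3 s) with hθs
  set Sf : Finset (Site 3) := box 3 (K * ((2 * s + 1) * m)) with hSf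
  set F : Set (BondConfig (Site 3)) := {ω' : BondConfig (Site 3) | ∀ x : Site 3,
      12 * joinedCount s ↑Sf G x ω' < 11 * largeCount s G ω'} with hF
  set X : BondConfig (Site 3) → ℝ := fun ω => (largeCount s G ω : ℝ) with hX
  set Y : BondConfig (Site 3) → ℝ := fun ω => ∑ y ∈ G, ∑ y' ∈ G,
      (openConnIn (↑Sf : Set (Site 3)) y y').indicator (fun _ => (1 : ℝ)) ω with hY
  have hXm : Measurable X := measurable_largeCount s G
  have hFm : MeasurableSet F := markov_measurableSet_noCapture s Sf G
  have hX2b : ∀ ω, |X ω ^ 2| ≤ g ^ 2 := fun ω => markov_abs_largeCount_sq_le s G ω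
  have hFX2b : ∀ ω, |F.indicator (fun ω' => X ω' ^ 2) ω| ≤ g ^ 2 := by
    intro ω
    by_cases h : ω ∈ F
    · rw [Set.indicator_of_mem h]; exact hX2b ω
    · rw [Set.indicator_of_notMem h, abs_zero]; positivity
  -- integrability (Y is a finite sum of indicators)
  have hYi : Integrable Y P := integrable_finsetSum _ fun y _ => integrable_finsetSum _ fun y' _ =>
    (integrable_const (1 : ℝ)).indicator (DCT16.measurableSet_openConnIn Sf y y')
  have hX2i : Integrable (fun ω => X ω ^ 2) P := markov_integrable_of_bound p (hXm.pow_const 2) hX2b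
  have hFX2i : Integrable (F.indicator fun ω' => X ω' ^ 2) P :=
    markov_integrable_of_bound p ((hXm.pow_const 2).indicator hFm) hFX2b
  -- E[Y] = the pair sum
  have hEY : ∫ ω, Y ω ∂P = ∑ y ∈ G, ∑ y' ∈ G, P.real (openConnIn (↑Sf : Set (Site 3)) y y') := by
    rw [hY, integral_finsetSum _ fun y _ => integrable_finsetSum _ fun y' _ =>
      (integrable_const (1 : ℝ)).indicator (DCT16.measurableSet_openConnIn Sf y y')]
    refine Finset.sum_congr rfl fun y _ => ?_
    rw [integral_finsetSum _ fun y' _ => (integrable_const (1 : ℝ)).indicator (DCT16.measurableSet_openConnIn Sf y y')]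
    refine Finset.sum_congr rfl fun y' _ => ?_
    rw [integral_indicator_const _ (DCT16.measurableSet_openConnIn Sf y y'), smul_eq_mul, mul_one]
  -- pointwise (A), almost surely
  have hA : ∀ᵐ ω ∂P, 12 * Y ω ≤ 12 * g + 12 * X ω ^ 2 - F.indicator (fun ω' => X ω' ^ 2) ω := by
    filter_upwards [ProbabilityTheory.setBernoulli_ae_subset (u := (zdGraph 3).edgeSet) (p := p)] with ω hω
    exact (stub_denseMarkovPointwise K s m ω).1 hω
  have hintA : ∫ ω, 12 * Y ω ∂P ≤ ∫ ω, (12 * g + 12 * X ω ^ 2 - F.indicator (fun ω' => X ω' ^ 2) ω) ∂P :=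
    integral_mono_ae (hYi.const_mul 12) (((integrable_const _).add (hX2i.const_mul 12)).sub hFX2i) hA
  have i0 : Integrable (fun _ : BondConfig (Site 3) => (12 * g : ℝ)) P := integrable_const _
  have i1 : Integrable (fun ω => 12 * X ω ^ 2) P := hX2i.const_mul 12
  have i2 : Integrable (fun ω => 12 * g + 12 * X ω ^ 2) P := i0.add i1
  have hR : ∫ ω, (12 * g + 12 * X ω ^ 2 - F.indicator (fun ω' => X ω' ^ 2) ω) ∂P =
      12 * g + 12 * ∫ ω, X ω ^ 2 ∂P - ∫ ω, F.indicator (fun ω' => X ω' ^ 2) ω ∂P := by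
    rw [integral_sub i2 hFX2i, integral_add i0 i1, integral_const_mul, integral_const, probReal_univ, one_smul,
      integral_const_mul]
  have hL : ∫ ω, 12 * Y ω ∂P = 12 * ∫ ω, Y ω ∂P := integral_const_mul _ _
  rw [hL, hR] at hintA
  -- the second moment of X
  have hfar : ∀ y ∈ G, ∀ y' ∈ G, y ≠ y' → ∃ i : Fin 3, ((2 * s + 1 : ℕ) : ℤ) ≤ |y i - y' i| := by
    intro y hy y' hy' hne
    obtain ⟨z, -, rfl⟩ := mem_coreGrid.1 hy
    obtain ⟨z', -, rfl⟩ := mem_coreGrid.1 hy'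
    exact exists_le_abs_sub_of_ne hne
  obtain ⟨-, hM2⟩ := stub_largeCountMoments p s G hfar
  have hM2' : ∫ ω, X ω ^ 2 ∂P ≤ g * θs + g ^ 2 * θs ^ 2 := hM2
  have hθs1 : θs ≤ 1 := measureReal_le_one
  have hθs0 : 0 ≤ θs := measureReal_nonneg
  have hg0 : 0 ≤ g := by positivity
  -- combine
  have hEY' : (1 - η) * θs ^ 2 * g ^ 2 ≤ ∫ ω, Y ω ∂P := by rw [hEY]; exact hpairs
  have : g * θs ≤ g := by nlinarith
  linarith

/-! ## The registered stub -/

/-- **Registered stub `stub_denseMarkov` of crux stmt-CriticalPhenomena-0857 (line `registered`, reshape 2)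
— the second-moment boost**: if the average in-`Λ(Kn)` connection probability of the pairs of core grid
points is `≥ (1 − η) θ_s²` (`θ_s = P_p(0 ↔ ∂Λ(s)) > 0`), the dense block fails with probability
`≤ 48 η + 200/(θ_s² m³)`. -/
theorem stub_denseMarkov :
    ∀ (p : unitInterval) (K s m : ℕ) (η : ℝ), 1 ≤ K → 1 ≤ m →
      0 < (bondPercolation (zdGraph 3) p).real (siteToBoundary 3 s) →
      (1 - η) * (bondPercolation (zdGraph 3) p).real (siteToBoundary 3 s) ^ 2 *
          ((coreGrid s m).card : ℝ) ^ 2 ≤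
        ∑ y ∈ coreGrid s m, ∑ y' ∈ coreGrid s m,
          (bondPercolation (zdGraph 3) p).real (openConnIn ↑(box 3 (K * ((2 * s + 1) * m))) y y') →
      (bondPercolation (zdGraph 3) p).real (denseBox K s m)ᶜ ≤
        48 * η + 200 / ((bondPercolation (zdGraph 3) p).real (siteToBoundary 3 s) ^ 2 * (m : ℝ) ^ 3) := by
  intro p K s m η _hK hm hθpos hpairs
  set P := bondPercolation (zdGraph 3) p with hP
  set G := coreGrid s m with hG
  set g : ℝ := (G.card : ℝ) with hg
  set θs : ℝ := P.real (siteToBoundary 3 s) with hθs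
  set Sf : Finset (Site 3) := box 3 (K * ((2 * s + 1) * m)) with hSf
  set F : Set (BondConfig (Site 3)) := {ω' : BondConfig (Site 3) | ∀ x : Site 3,
      12 * joinedCount s ↑Sf G x ω' < 11 * largeCount s G ω'} with hF
  set X : BondConfig (Site 3) → ℝ := fun ω => (largeCount s G ω : ℝ) with hX
  let Xh : Fin 2 → Bool → BondConfig (Site 3) → ℝ := fun i b ω => (largeCount s (halfGrid s m i b) ω : ℝ)
  let gh : Fin 2 → Bool → ℝ := fun i b => ((halfGrid s m i b).card : ℝ)
  have hθs1 : θs ≤ 1 := measureReal_le_one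
  have hg_card : g = (2 * (m : ℝ) + 1) ^ 3 := by rw [hg, hG, card_coreGrid]; push_cast; ring
  have hmpos : (0 : ℝ) < m := by exact_mod_cast hm
  have hm3 : 0 < (m : ℝ) ^ 3 := pow_pos hmpos 3
  have hden : 0 < θs ^ 2 * (m : ℝ) ^ 3 := by positivity
  have hg_ge : (m : ℝ) ^ 3 ≤ g := by rw [hg_card]; nlinarith [pow_le_pow_left₀ (by positivity : (0:ℝ) ≤ m) (by linarith : (m : ℝ) ≤ 2 * m + 1) 3]
  have hgpos : 0 < g := lt_of_lt_of_le (by positivity) hg_ge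
  have hgh_ge : ∀ i b, g ≤ 2 * gh i b := fun i b => by
    have h := markov_card_coreGrid_le_two_mul s m i b
    show ((coreGrid s m).card : ℝ) ≤ 2 * ((halfGrid s m i b).card : ℝ)
    exact_mod_cast h
  have hgh_pos : ∀ i b, 0 < gh i b := fun i b => by linarith [hgh_ge i b]
  have hgh_m : ∀ i b, (m : ℝ) ^ 3 ≤ gh i b := fun i b => by
    have h8 : 8 * (m : ℝ) ^ 3 ≤ g := by rw [hg_card]; nlinarith [pow_le_pow_left₀ (by positivity : (0:ℝ) ≤ 2 * m) (by linarith : 2 * (m : ℝ) ≤ 2 * m + 1) 3]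
    linarith [hgh_ge i b]
  -- measurability
  have hXm : Measurable X := measurable_largeCount s G
  have hFm : MeasurableSet F := markov_measurableSet_noCapture s Sf G
  -- (1) the Markov event B = F ∩ {θs g / 2 < X}
  set B : Set (BondConfig (Site 3)) := F ∩ {ω | θs * g / 2 < X ω} with hB
  have hBm : MeasurableSet B := hFm.inter (measurableSet_lt measurable_const hXm)
  have hEFX2 := markov_integral_indicator_sq_le p K s m η hpairs
  have hPB : P.real B ≤ 96 / (θs ^ 2 * g) + 48 * η := by
    have hX2b : ∀ ω, |X ω ^ 2| ≤ g ^ 2 := fun ω => markov_abs_largeCount_sq_le s G ω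
    have hFX2i : Integrable (F.indicator fun ω' => X ω' ^ 2) P := by
      refine markov_integrable_of_bound p ((hXm.pow_const 2).indicator hFm) (C := g ^ 2) fun ω => ?_
      by_cases h : ω ∈ F
      · rw [Set.indicator_of_mem h]; exact hX2b ω
      · rw [Set.indicator_of_notMem h, abs_zero]; positivity
    have hptw : ∀ ω, B.indicator (fun _ => (θs * g / 2) ^ 2) ω ≤ F.indicator (fun ω' => X ω' ^ 2) ω := by
      intro ω
      by_cases hω : ω ∈ B
      · rw [Set.indicator_of_mem hω, Set.indicator_of_mem hω.1]
        have h : θs * g / 2 < X ω := hω.2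
        exact pow_le_pow_left₀ (by positivity) h.le 2
      · rw [Set.indicator_of_notMem hω]
        exact Set.indicator_nonneg (fun _ _ => by positivity) _
    have hint : P.real B * (θs * g / 2) ^ 2 ≤ 24 * g + 12 * η * θs ^ 2 * g ^ 2 := by
      have h := integral_mono ((integrable_const _).indicator hBm) hFX2i hptw
      rw [integral_indicator_const _ hBm, smul_eq_mul] at h
      exact h.trans hEFX2
    have hden : 0 < (θs * g / 2) ^ 2 := by positivity
    calc P.real B ≤ (24 * g + 12 * η * θs ^ 2 * g ^ 2) / (θs * g / 2) ^ 2 := by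
          rw [le_div_iff₀ hden]; exact hint
      _ = 96 / (θs ^ 2 * g) + 48 * η := by
          field_simp
          ring
  -- (2) Chebyshev for the core grid and the half-grids
  have hfar : ∀ (Gs : Finset (Site 3)), Gs ⊆ G →
      ∀ y ∈ Gs, ∀ y' ∈ Gs, y ≠ y' → ∃ i : Fin 3, ((2 * s + 1 : ℕ) : ℤ) ≤ |y i - y' i| := by
    intro Gs hGs y hy y' hy' hne
    obtain ⟨z, -, rfl⟩ := mem_coreGrid.1 (hGs hy)
    obtain ⟨z', -, rfl⟩ := mem_coreGrid.1 (hGs hy')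
    exact exists_le_abs_sub_of_ne hne
  have hcheb : ∀ (Gs : Finset (Site 3)), Gs ⊆ G → 0 < (Gs.card : ℝ) →
      P.real {ω | θs * Gs.card / 2 ≤ |(largeCount s Gs ω : ℝ) - Gs.card * θs|} ≤ 4 / (θs * Gs.card) := by
    intro Gs hGs hcard
    obtain ⟨hM1, hM2⟩ := stub_largeCountMoments p s Gs (hfar Gs hGs)
    have hb : ∀ ω, |(largeCount s Gs ω : ℝ)| ≤ Gs.card := fun ω => by
      rw [abs_of_nonneg (by positivity)]; exact_mod_cast largeCount_le_card s Gs ω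
    have h2' : ∫ ω, (largeCount s Gs ω : ℝ) ^ 2 ∂P ≤ Gs.card * θs + (Gs.card * θs) ^ 2 := by
      have : (Gs.card : ℝ) ^ 2 * θs ^ 2 = (Gs.card * θs) ^ 2 := by ring
      linarith [hM2]
    have h := markov_chebyshev p (measurable_largeCount s Gs) hb hM1 h2' (t := θs * Gs.card / 2)
      (by positivity)
    calc P.real {ω | θs * Gs.card / 2 ≤ |(largeCount s Gs ω : ℝ) - Gs.card * θs|}
        ≤ Gs.card * θs / (θs * Gs.card / 2) ^ 2 := h
      _ = 4 / (θs * Gs.card) := by field_simp; ring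
  set B0 : Set (BondConfig (Site 3)) := {ω | θs * g / 2 ≤ |X ω - g * θs|} with hB0
  set Bh : Fin 2 × Bool → Set (BondConfig (Site 3)) :=
    fun j => {ω | θs * gh j.1 j.2 / 2 ≤ |Xh j.1 j.2 ω - gh j.1 j.2 * θs|} with hBh
  have hPB0 : P.real B0 ≤ 4 / (θs * g) := hcheb G (Finset.Subset.refl _) hgpos
  have hPBh : ∀ j, P.real (Bh j) ≤ 4 / (θs * gh j.1 j.2) := fun j =>
    hcheb (halfGrid s m j.1 j.2) (halfGrid_subset_coreGrid s m j.1 j.2) (hgh_pos j.1 j.2)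
  -- (3) the inclusion: not dense ⊆ B ∪ B0 ∪ ⋃ Bh
  have hincl : (denseBox K s m)ᶜ ⊆ (B ∪ B0) ∪ ⋃ j ∈ (Finset.univ : Finset (Fin 2 × Bool)), Bh j := by
    intro ω hω
    rw [Set.mem_compl_iff] at hω
    by_cases h0 : ω ∈ B0
    · exact Or.inl (Or.inr h0)
    have hX0 : |X ω - g * θs| < θs * g / 2 := not_le.1 h0
    rw [abs_lt] at hX0
    rcases (stub_denseMarkovPointwise K s m ω).2 hω with hFω | ⟨i, b, hsparse⟩
    · refine Or.inl (Or.inl ⟨hFω, ?_⟩)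
      show θs * g / 2 < X ω
      linarith [hX0.1]
    · by_cases hj : ω ∈ Bh (i, b)
      · exact Or.inr (Set.mem_biUnion (Finset.mem_univ (i, b)) hj)
      · exfalso
        have hXh0 : |Xh i b ω - gh i b * θs| < θs * gh i b / 2 := not_le.1 hj
        rw [abs_lt] at hXh0
        have hs' : 6 * Xh i b ω ≤ X ω := by
          show 6 * (largeCount s (halfGrid s m i b) ω : ℝ) ≤ (largeCount s G ω : ℝ)
          exact_mod_cast hsparse
        have h2 := hgh_ge i b
        have h5 : g * θs ≤ 2 * gh i b * θs := mul_le_mul_of_nonneg_right h2 hθpos.le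
        linarith [hXh0.1, hX0.2, h5, hs']
  -- (4) union bound and arithmetic
  have hU : P.real (denseBox K s m)ᶜ ≤ P.real B + P.real B0 + ∑ j ∈ (Finset.univ : Finset (Fin 2 × Bool)),
      P.real (Bh j) := by
    calc P.real (denseBox K s m)ᶜ
        ≤ P.real ((B ∪ B0) ∪ ⋃ j ∈ (Finset.univ : Finset (Fin 2 × Bool)), Bh j) :=
          measureReal_mono hincl (measure_ne_top _ _)
      _ ≤ P.real (B ∪ B0) + P.real (⋃ j ∈ (Finset.univ : Finset (Fin 2 × Bool)), Bh j) :=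
          measureReal_union_le _ _
      _ ≤ (P.real B + P.real B0) + ∑ j ∈ (Finset.univ : Finset (Fin 2 × Bool)), P.real (Bh j) :=
          add_le_add (measureReal_union_le _ _) (measureReal_biUnion_finset_le _ _)
  have hsum : ∑ j ∈ (Finset.univ : Finset (Fin 2 × Bool)), P.real (Bh j) ≤ 16 / (θs ^ 2 * (m : ℝ) ^ 3) := by
    have hterm : ∀ j ∈ (Finset.univ : Finset (Fin 2 × Bool)), P.real (Bh j) ≤ 4 / (θs ^ 2 * (m : ℝ) ^ 3) := by
      intro j _
      refine (hPBh j).trans ?_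
      rw [div_le_div_iff₀ (mul_pos hθpos (hgh_pos j.1 j.2)) hden]
      have a1 : θs ^ 2 * (m : ℝ) ^ 3 ≤ θs * (m : ℝ) ^ 3 := by
        apply mul_le_mul_of_nonneg_right _ hm3.le
        nlinarith [hθpos, hθs1]
      have a2 : θs * (m : ℝ) ^ 3 ≤ θs * gh j.1 j.2 := mul_le_mul_of_nonneg_left (hgh_m j.1 j.2) hθpos.le
      linarith [a1, a2]
    calc ∑ j ∈ (Finset.univ : Finset (Fin 2 × Bool)), P.real (Bh j)
        ≤ ∑ _j ∈ (Finset.univ : Finset (Fin 2 × Bool)), 4 / (θs ^ 2 * (m : ℝ) ^ 3) := Finset.sum_le_sum hterm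
      _ = 16 / (θs ^ 2 * (m : ℝ) ^ 3) := by
          rw [Finset.sum_const, Finset.card_univ, nsmul_eq_mul,
            show Fintype.card (Fin 2 × Bool) = 4 from rfl]
          push_cast
          ring
  have h96 : 96 / (θs ^ 2 * g) ≤ 96 / (θs ^ 2 * (m : ℝ) ^ 3) :=
    div_le_div_of_nonneg_left (by norm_num) hden
      (mul_le_mul_of_nonneg_left hg_ge (pow_pos hθpos 2).le)
  have h4 : 4 / (θs * g) ≤ 4 / (θs ^ 2 * (m : ℝ) ^ 3) := by
    refine div_le_div_of_nonneg_left (by norm_num) hden ?_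
    have a1 : θs ^ 2 * (m : ℝ) ^ 3 ≤ θs * (m : ℝ) ^ 3 := by
      apply mul_le_mul_of_nonneg_right _ hm3.le
      nlinarith [hθpos, hθs1]
    have a2 : θs * (m : ℝ) ^ 3 ≤ θs * g := mul_le_mul_of_nonneg_left hg_ge hθpos.le
    linarith [a1, a2]
  have htotal : P.real (denseBox K s m)ᶜ ≤ 48 * η + 116 / (θs ^ 2 * (m : ℝ) ^ 3) := by
    have e : 116 / (θs ^ 2 * (m : ℝ) ^ 3) = 96 / (θs ^ 2 * (m : ℝ) ^ 3) + 4 / (θs ^ 2 * (m : ℝ) ^ 3) +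
        16 / (θs ^ 2 * (m : ℝ) ^ 3) := by ring
    linarith [hU, hPB, hPB0, hsum, h96, h4]
  have hmono : 116 / (θs ^ 2 * (m : ℝ) ^ 3) ≤ 200 / (θs ^ 2 * (m : ℝ) ^ 3) :=
    div_le_div_of_nonneg_right (by norm_num) hden.le
  linarith

end Summit.CriticalPhenomena.PercolationContinuityZ3.Theorems.RenormaliseFromLinearLRO

end
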